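import Summits.QuantumFields.YangMills.Theorems.ColdStartUniversalityLatticeLangevinWilsonGeneratorPoincare
import Summits.QuantumFields.YangMills.Theorems.ColdStartUniversalityEntropyFlowTools
import Literature.Probability.MarkovChains.HolleyStroockPerturbation
import HarnessLib

/-!
# Route `ColdStartUniversality` (fixed-cut-off package, entropy side): GENERATOR-FORM LOG-SOBOLEV on `C³` cylinders ⇒
# SEMIGROUP-FORM LOG-SOBOLEV on `C(X)`, same constant — no core, no smoothing hypothesis

Helper file (seat `ym-line-csu-p1`, g21; `--supports stmt-QuantumFields-27363`).  SU(2) SZZ dynamics at `(L, β')`, `μ = μ_{β'}`, ANY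
realising kernel family `κ`, scale-`h` forms `h𝓔_h(G) = ∫ G² dμ − ∫ Gκ_hG dμ`:
* ★ `exists_cylinder_uniform_energy_approx` — UNIFORM approximation in energy: if `𝓔_h(G) ≤ E` (`h > 0`, `G` continuous) then for
  every `ε ∈ (0,1]` some `C³` compactly supported cylinder `F = f∘coords` has `|G − F| ≤ ε` EVERYWHERE and `𝓔_h(F − G) ≤ Aε` at small
  scales (g18's construction `F = κ⁰_s R` + uniform strong continuity `κ⁰_s G → G` by the tube lemma);
* `entropy_nonneg` — `Ent_ν(g) ≥ 0`; `mul_entropy_le_of_logSobolev_of_eventually_le` — bookkeeping;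
* ★★ `semigroupLogSobolev_of_generatorLogSobolev` — if `ρ Ent_μ(F²) ≤ −∫ F·𝓛f dμ` for all `C³` `f` (`Ent_μ(g) = ∫ g log g dμ −
  (∫g) log ∫g`), then every continuous `G` has `(ρ − η) Ent_μ(G²) ≤ 𝓔_h(G)` for some `h > 0`, every `η > 0`: the log-Sobolev
  inequality on the ENERGY SPACE `ρ Ent_μ(G²) ≤ sup_h 𝓔_h(G)`, applied in the sequel `…WilsonEntropyDecay` to `G = √(κ_t F)`.
THEOREMS ONLY, no definition, no sorry.  HONEST FRAMING: RECORD-rung R3 plumbing at FIXED cut-off; the log-Sobolev inequality itself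
(let alone uniformly in the cut-off) is NOT proved here; no crux, rung or summit statement is proved; the Yang–Mills mass gap is NOT proved.
-/

set_option autoImplicit false

noncomputable section

namespace Summit.QuantumFields.YangMills.Theorems.ColdStartUniversality

open MeasureTheory ProbabilityTheory Filter Set Topology
open scoped BigOperators NNReal ENNReal
open Literature.Probability.Process Literature.MathematicalPhysics.QuantumFieldTheory
open Literature.MathematicalPhysics.QuantumLattice (fundamentalRep fundamentalLatticeRep continuous_fundamentalRep)

variable {L : ℕ} [NeZero L]

/-! ## §1. Uniform approximation in energy by `C³` cylinders -/

/-- ★ **Uniform approximation in energy.**  Let `G` be continuous with `𝓔_h(G) ≤ E` for all `h > 0`.  Then there is `A ≥ 0` such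
that for every `ε ∈ (0, 1]` some `C³` compactly supported `f` satisfies `|G(x) − f(coords x)| ≤ ε` for ALL `x` and
`𝓔_h(f∘coords − G) ≤ A ε` for all small `h > 0`.  (`f∘coords = κ⁰_s R` with `R` a ridge function `εs/2`-close to `G` and `s` so
small that `|κ⁰_s G − G| ≤ ε/2` uniformly.) [cite: BakryGentilLedoux2014, §3.1.8 and Prop. 3.1.6] -/
theorem exists_cylinder_uniform_energy_approx (L : ℕ) [NeZero L] (β' : ℝ)
    (κ : ℝ≥0 → Kernel (GaugeConfig 3 L (Matrix.specialUnitaryGroup (Fin 2) ℂ))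
      (GaugeConfig 3 L (Matrix.specialUnitaryGroup (Fin 2) ℂ))) [∀ t, IsMarkovKernel (κ t)]
    (hreal : ∀ (t : ℝ≥0) (x : GaugeConfig 3 L (Matrix.specialUnitaryGroup (Fin 2) ℂ))
        (Ω : Type) [MeasurableSpace Ω] (P : Measure Ω) [IsProbabilityMeasure P]
        (W : ℝ≥0 → Ω → (Edge 3 L × NoiseIdx 2 → ℝ)) (hW : IsFlatBrownian W P)
        (U : ℝ≥0 → Ω → GaugeConfig 3 L (Matrix.specialUnitaryGroup (Fin 2) ℂ)),
        (∀ ω, U 0 ω = x) →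
        (latticeLangevinDynamics (fundamentalLatticeRep 2) β').IsSolution (fundamentalRep (Fin 2))
          hW.natFiltration P W U →
        κ t x = P.map (U t))
    {G : GaugeConfig 3 L (Matrix.specialUnitaryGroup (Fin 2) ℂ) → ℝ} (hG : Continuous G) {E : ℝ}
    (hE : ∀ h : ℝ≥0, 0 < h →
      (h : ℝ)⁻¹ * ((∫ x, G x * G x ∂(wilsonMeasure (d := 3) (L := L) (fundamentalRep (Fin 2)) β')) -
        ∫ x, G x * (∫ y, G y ∂(κ h x)) ∂(wilsonMeasure (d := 3) (L := L) (fundamentalRep (Fin 2)) β')) ≤ E) :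
    ∃ A : ℝ, 0 ≤ A ∧ ∀ ε : ℝ, 0 < ε → ε ≤ 1 →
      ∃ f : (Edge 3 L × Fin 2 × Fin 2 × Bool → ℝ) → ℝ, ContDiff ℝ 3 f ∧ HasCompactSupport f ∧
        let coords : GaugeConfig 3 L (Matrix.specialUnitaryGroup (Fin 2) ℂ) → (Edge 3 L × Fin 2 × Fin 2 × Bool → ℝ) :=
          fun V q => (fun z : ℂ => if q.2.2.2 then z.im else z.re)
            ((fundamentalRep (Fin 2) (V q.1) : Matrix (Fin 2) (Fin 2) ℂ) q.2.1 q.2.2.1)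
        (∀ x, |G x - f (coords x)| ≤ ε) ∧
        ∃ h₀ : ℝ≥0, 0 < h₀ ∧ ∀ h : ℝ≥0, 0 < h → h ≤ h₀ →
          (h : ℝ)⁻¹ * ((∫ x, (f (coords x) - G x) * (f (coords x) - G x)
              ∂(wilsonMeasure (d := 3) (L := L) (fundamentalRep (Fin 2)) β')) -
            ∫ x, (f (coords x) - G x) * (∫ y, (f (coords y) - G y) ∂(κ h x))
              ∂(wilsonMeasure (d := 3) (L := L) (fundamentalRep (Fin 2)) β')) ≤ A * ε := by
  classical
  haveI := secondCountableTopology_su2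
  haveI := borelSpace_config L
  set μ : Measure (GaugeConfig 3 L (Matrix.specialUnitaryGroup (Fin 2) ℂ)) :=
    wilsonMeasure (d := 3) (L := L) (fundamentalRep (Fin 2)) β' with hμ
  set μ₀ : Measure (GaugeConfig 3 L (Matrix.specialUnitaryGroup (Fin 2) ℂ)) :=
    wilsonMeasure (d := 3) (L := L) (fundamentalRep (Fin 2)) 0 with hμ₀
  haveI : IsProbabilityMeasure μ :=
    isProbabilityMeasure_wilsonMeasure (d := 3) (L := L) (fundamentalRep (Fin 2)) (continuous_fundamentalRep (Fin 2)) β'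
  haveI : IsProbabilityMeasure μ₀ :=
    isProbabilityMeasure_wilsonMeasure (d := 3) (L := L) (fundamentalRep (Fin 2)) (continuous_fundamentalRep (Fin 2)) 0
  -- the `β' = 0` kernels, the comparison constants, the `β' = 0` energy bound
  obtain ⟨κ₀, hκ₀M, -, hreal₀⟩ := exists_transitionKernel L 0
  haveI := hκ₀M
  obtain ⟨K, C, hC, hcmp⟩ := exists_dirichletScale_le_mul_beta_zero L β'
  obtain ⟨E₀, hE₀0, -, hsmall⟩ := exists_energy_bound_beta_zero L β' κ hreal κ₀ hreal₀ hG hE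
  refine ⟨5 * C * Real.exp |K|, by positivity, fun ε hε hε1 => ?_⟩
  obtain ⟨s₀, hs₀, h₀, hh₀, hsm⟩ := hsmall ε hε
  -- uniform strong continuity at `β' = 0`: `|κ⁰_t G − G| < ε/2` for `t < s₁`
  have hjc : Continuous (Function.uncurry fun (t : ℝ≥0) (x : GaugeConfig 3 L (Matrix.specialUnitaryGroup (Fin 2) ℂ)) =>
      ∫ y, G y ∂(κ₀ t x)) := continuous_transitionKernel_action 0 κ₀ hreal₀ hG
  have hκ00 : κ₀ 0 = Kernel.id := transitionKernel_zero_eq_id L 0 κ₀ hreal₀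
  have hev := eventually_forall_abs_sub_lt_of_continuous_uncurry hjc 0 (show (0 : ℝ) < ε / 2 by positivity)
  obtain ⟨s₁, hs₁, hball⟩ := NNReal.nhds_zero_basis.eventually_iff.1 hev
  -- the smoothing time `s = min(s₀, ε/2, s₁/2)` and the ridge tolerance `δ = ε s`
  set s : ℝ≥0 := min (min s₀ ⟨ε / 2, by positivity⟩) (s₁ / 2) with hsdef
  have hs : 0 < s := lt_min (lt_min hs₀ (by exact_mod_cast (show (0 : ℝ) < ε / 2 by positivity))) (half_pos hs₁)
  have hss₀ : s ≤ s₀ := (min_le_left _ _).trans (min_le_left _ _)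
  have hss₁ : s < s₁ := lt_of_le_of_lt (min_le_right _ _) (NNReal.half_lt_self hs₁.ne')
  have hsR : (0 : ℝ) < s := by exact_mod_cast hs
  have hsε2 : (s : ℝ) ≤ ε / 2 := by
    have : s ≤ ⟨ε / 2, by positivity⟩ := (min_le_left _ _).trans (min_le_right _ _)
    exact_mod_cast this
  have hsε : (s : ℝ) ≤ ε := by linarith
  have hs1 : (s : ℝ) ≤ 1 := hsε.trans hε1
  obtain ⟨R, hRc, hRG, f, hf, hfc, hfeq⟩ :=
    exists_ridge_near_and_cylinder_transition L κ₀ hreal₀ hG (show (0 : ℝ) < ε * s by positivity) s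
  have hδ : ∀ x, |R x - G x| ≤ ε * s := fun x => (hRG x).le
  refine ⟨f, hf, hfc, ?_⟩
  intro coords
  have hfx : ∀ x, f (coords x) = ∫ y, R y ∂(κ₀ s x) := fun x => hfeq x
  have hKRc : Continuous fun x => ∫ y, R y ∂(κ₀ s x) := continuous_integral_transitionKernel L 0 κ₀ hreal₀ s hRc
  refine ⟨?_, min h₀ 1, lt_min hh₀ one_pos, fun h hh hhle => ?_⟩
  · intro x
    rw [hfx x]
    -- `|κ⁰_s R − κ⁰_s G| ≤ ε s ≤ ε/2` and `|κ⁰_s G − G| < ε/2`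
    have h1 : |(∫ y, R y ∂(κ₀ s x)) - ∫ y, G y ∂(κ₀ s x)| ≤ ε * s :=
      abs_integral_sub_integral_le_of_abs_sub_le (μ := κ₀ s x) hRc hG hδ
    have h2 : |(∫ y, G y ∂(κ₀ s x)) - G x| < ε / 2 := by
      have := hball (show s ∈ Iio s₁ from hss₁) x
      simpa only [hκ00, Kernel.id_apply, integral_dirac] using this
    have h3 : ε * (s : ℝ) ≤ ε / 2 := by nlinarith
    rw [abs_sub_comm]
    calc |(∫ y, R y ∂(κ₀ s x)) - G x|
        = |((∫ y, R y ∂(κ₀ s x)) - ∫ y, G y ∂(κ₀ s x)) + ((∫ y, G y ∂(κ₀ s x)) - G x)| := by ring_nf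
      _ ≤ |(∫ y, R y ∂(κ₀ s x)) - ∫ y, G y ∂(κ₀ s x)| + |(∫ y, G y ∂(κ₀ s x)) - G x| := abs_add_le _ _
      _ ≤ ε := by linarith [h2.le]
  · have hhh₀ : h ≤ h₀ := hhle.trans (min_le_left _ _)
    have hh1 : h ≤ 1 := hhle.trans (min_le_right _ _)
    have hhR : (0 : ℝ) < h := by exact_mod_cast hh
    simp_rw [hfx]
    have hw : Continuous fun x => (∫ y, R y ∂(κ₀ s x)) - G x := hKRc.sub hG
    have h1 := dirichletScale_transition_near_sub_le L κ₀ hreal₀ hG hRc hδ hs h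
    have h2 := hsm s hs hss₀ h hh hhh₀
    rw [inv_mul_le_iff₀ hhR] at h2
    have h3 := (hcmp κ hreal κ₀ hreal₀ (fun x => (∫ y, R y ∂(κ₀ s x)) - G x) hw h).1
    have hexp : Real.exp (K * h) ≤ Real.exp |K| := by
      refine Real.exp_le_exp.2 ?_
      have h1' : (h : ℝ) ≤ 1 := by exact_mod_cast hh1
      calc K * h ≤ |K| * h := mul_le_mul_of_nonneg_right (le_abs_self K) hhR.le
        _ ≤ |K| * 1 := mul_le_mul_of_nonneg_left h1' (abs_nonneg K)
        _ = |K| := mul_one _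
    have h4 : (h : ℝ) / s * (ε * s) ^ 2 ≤ (h : ℝ) * ε := by
      rw [div_mul_eq_mul_div, div_le_iff₀ hsR]
      have h7 : ε * (s : ℝ) ≤ 1 := by nlinarith [hε.le, hε1, hsR.le, hs1]
      calc (h : ℝ) * (ε * s) ^ 2 = ((h : ℝ) * ε * s) * (ε * s) := by ring
        _ ≤ ((h : ℝ) * ε * s) * 1 := mul_le_mul_of_nonneg_left h7 (by positivity)
        _ = (h : ℝ) * ε * s := mul_one _
    have hQ0 : (∫ x, ((∫ y, R y ∂(κ₀ s x)) - G x) * ((∫ y, R y ∂(κ₀ s x)) - G x) ∂μ₀) -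
        ∫ x, ((∫ y, R y ∂(κ₀ s x)) - G x) * (∫ y, ((∫ z, R z ∂(κ₀ s y)) - G y) ∂(κ₀ h x)) ∂μ₀ ≤ 5 * ε * h := by
      refine h1.trans ?_
      nlinarith [h2, h4, hhR.le, hε.le]
    rw [inv_mul_le_iff₀ hhR]
    calc (∫ x, ((∫ y, R y ∂(κ₀ s x)) - G x) * ((∫ y, R y ∂(κ₀ s x)) - G x) ∂μ) -
          ∫ x, ((∫ y, R y ∂(κ₀ s x)) - G x) * (∫ y, ((∫ z, R z ∂(κ₀ s y)) - G y) ∂(κ h x)) ∂μ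
        ≤ C * Real.exp (K * h) * (5 * ε * h) := h3.trans (mul_le_mul_of_nonneg_left hQ0 (by positivity))
      _ ≤ C * Real.exp |K| * (5 * ε * h) :=
          mul_le_mul_of_nonneg_right (mul_le_mul_of_nonneg_left hexp hC.le) (by positivity)
      _ = (h : ℝ) * (5 * C * Real.exp |K| * ε) := by ring

/-! ## §2. Entropy is non-negative -/

/-- **`Ent_ν(g) ≥ 0`** for a probability measure `ν` and `g ≥ 0` with `g`, `g log g` integrable:
`∫ g log g dν − (∫ g dν) log(∫ g dν) = ∫ (g log g − g log m − g + m) dν ≥ 0`, `m = ∫ g dν` (the integrand is non-negative,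
`Literature.Probability.MarkovChains.mul_log_sub_mul_log_sub_add_nonneg`). [folklore] -/
theorem entropy_nonneg {X : Type*} [MeasurableSpace X] (ν : Measure X) [IsProbabilityMeasure ν] {g : X → ℝ}
    (hg0 : ∀ x, 0 ≤ g x) (hg : Integrable g ν) (hgl : Integrable (fun x => g x * Real.log (g x)) ν) :
    0 ≤ (∫ x, g x * Real.log (g x) ∂ν) - (∫ x, g x ∂ν) * Real.log (∫ x, g x ∂ν) := by
  rcases (integral_nonneg hg0 : 0 ≤ ∫ x, g x ∂ν).lt_or_eq with hm | hm
  · rw [← Literature.Probability.MarkovChains.integral_sub_log_mean_eq_entropy ν hg hgl]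
    exact integral_nonneg fun x => Literature.Probability.MarkovChains.mul_log_sub_mul_log_sub_add_nonneg (hg0 x) hm
  · -- `∫ g = 0`: `g = 0` a.e., the entropy vanishes
    have hae : g =ᵐ[ν] 0 := (integral_eq_zero_iff_of_nonneg hg0 hg).1 hm.symm
    have e2 : ∫ x, g x * Real.log (g x) ∂ν = 0 := by
      have : (fun x => g x * Real.log (g x)) =ᵐ[ν] 0 := by
        filter_upwards [hae] with x hx
        simp [hx]
      rw [integral_congr_ae this]; simp
    rw [e2, ← hm]; simp

/-! ## §3. Generator-form log-Sobolev ⇒ semigroup-form log-Sobolev -/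

/-- **Bookkeeping**: if `F = f∘c` satisfies the generator-form log-Sobolev inequality `ρ Ent_μ(F²) ≤ −∫ F g dμ`, the semigroup
Dirichlet forms converge `τ⁻¹(∫ F·A_τ − ∫ F²) → ∫ F g` as `τ ↓ 0`, and eventually `τ⁻¹(∫ F² − ∫ F·B_τ) ≤ M` (`A_τ = B_τ`), then
`ρ Ent_μ(F²) ≤ M`. [folklore] -/
theorem mul_entropy_le_of_logSobolev_of_eventually_le {X : Type*} [MeasurableSpace X] {μ : Measure X}
    {ι : Type*} {f : (ι → ℝ) → ℝ} {c : X → ι → ℝ} {Fs g : X → ℝ} {A B : ℝ → X → ℝ} {ρ M : ℝ}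
    (hfeq : ∀ V, Fs V = f (c V))
    (hLS : ρ * ((∫ V, f (c V) ^ 2 * Real.log (f (c V) ^ 2) ∂μ) - (∫ V, f (c V) ^ 2 ∂μ) * Real.log (∫ V, f (c V) ^ 2 ∂μ)) ≤
      -∫ V, f (c V) * g V ∂μ)
    (hT : Tendsto (fun τ : ℝ => τ⁻¹ * ((∫ V, f (c V) * A τ V ∂μ) - ∫ V, f (c V) * f (c V) ∂μ)) (𝓝[>] 0)
      (𝓝 (∫ V, f (c V) * g V ∂μ)))
    (hAB : ∀ τ V, A τ V = B τ V)
    (hbound : ∀ᶠ τ : ℝ in 𝓝[>] 0, τ⁻¹ * ((∫ V, Fs V * Fs V ∂μ) - ∫ V, Fs V * B τ V ∂μ) ≤ M) :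
    ρ * ((∫ V, Fs V ^ 2 * Real.log (Fs V ^ 2) ∂μ) - (∫ V, Fs V ^ 2 ∂μ) * Real.log (∫ V, Fs V ^ 2 ∂μ)) ≤ M := by
  have e : ∀ V, f (c V) = Fs V := fun V => (hfeq V).symm
  simp only [e, hAB] at hLS hT
  have hT' : Tendsto (fun τ : ℝ => τ⁻¹ * ((∫ V, Fs V * Fs V ∂μ) - ∫ V, Fs V * B τ V ∂μ)) (𝓝[>] 0)
      (𝓝 (-(∫ V, Fs V * g V ∂μ))) :=
    hT.neg.congr' (Eventually.of_forall fun τ => by ring)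
  have hlim : -(∫ V, Fs V * g V ∂μ) ≤ M := le_of_tendsto hT' hbound
  linarith

/-- ★★ **Generator-form log-Sobolev on `C³` cylinders ⇒ semigroup-form log-Sobolev on `C(X)`, same constant, NO smoothing
hypothesis.**  If `ρ Ent_μ(F²) ≤ −∫ F·𝓛f dμ_{β'}` for every `C³` `f`, `F = f∘coords` (`Ent_μ(g) = ∫ g log g dμ − (∫ g) log ∫ g`),
then every continuous `G` satisfies, for every `η > 0`, `(ρ − η) Ent_μ(G²) ≤ 𝓔_h(G)` for some `h > 0`.  Proof: if the energies
`𝓔_h(G)` are unbounded there is nothing to do; otherwise, with `E = sup_h 𝓔_h(G)` and the uniform approximants `F_ε` of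
`exists_cylinder_uniform_energy_approx`, `ρ Ent_μ(F_ε²) ≤ (1+t)E + (1+t⁻¹)Aε` (`dirichletScale_add_le`, `tendsto_dirichletForm_semigroup`)
and `Ent_μ(F_ε²) → Ent_μ(G²)` as `ε → 0` (uniform convergence), so `ρ Ent_μ(G²) ≤ E`.  The entropy analogue of
`semigroupPoincare_of_generatorPoincare` (g18). [cite: BakryGentilLedoux2014, Thm 5.2.1 and §3.2] -/
theorem semigroupLogSobolev_of_generatorLogSobolev (L : ℕ) [NeZero L] (β' : ℝ)
    (κ : ℝ≥0 → Kernel (GaugeConfig 3 L (Matrix.specialUnitaryGroup (Fin 2) ℂ))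
      (GaugeConfig 3 L (Matrix.specialUnitaryGroup (Fin 2) ℂ))) [∀ t, IsMarkovKernel (κ t)]
    (hreal : ∀ (t : ℝ≥0) (x : GaugeConfig 3 L (Matrix.specialUnitaryGroup (Fin 2) ℂ))
        (Ω : Type) [MeasurableSpace Ω] (P : Measure Ω) [IsProbabilityMeasure P]
        (W : ℝ≥0 → Ω → (Edge 3 L × NoiseIdx 2 → ℝ)) (hW : IsFlatBrownian W P)
        (U : ℝ≥0 → Ω → GaugeConfig 3 L (Matrix.specialUnitaryGroup (Fin 2) ℂ)),
        (∀ ω, U 0 ω = x) →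
        (latticeLangevinDynamics (fundamentalLatticeRep 2) β').IsSolution (fundamentalRep (Fin 2))
          hW.natFiltration P W U →
        κ t x = P.map (U t))
    {ρ : ℝ}
    (hLSgen : ∀ (f : (Edge 3 L × Fin 2 × Fin 2 × Bool → ℝ) → ℝ), ContDiff ℝ 3 f →
        let coords : GaugeConfig 3 L (Matrix.specialUnitaryGroup (Fin 2) ℂ) → (Edge 3 L × Fin 2 × Fin 2 × Bool → ℝ) :=
          fun V q => (fun z : ℂ => if q.2.2.2 then z.im else z.re)
            ((fundamentalRep (Fin 2) (V q.1) : Matrix (Fin 2) (Fin 2) ℂ) q.2.1 q.2.2.1)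
        let gen : GaugeConfig 3 L (Matrix.specialUnitaryGroup (Fin 2) ℂ) → ℝ := fun V =>
          (∑ i : Edge 3 L × Fin 2 × Fin 2 × Bool, fderiv ℝ f (coords V) (Pi.single i 1) *
              (fun z : ℂ => if i.2.2.2 then z.im else z.re)
                ((latticeLangevinDynamics (fundamentalLatticeRep 2) β').drift
                  (matrixConfig (fundamentalRep (Fin 2)) V) i.1 i.2.1 i.2.2.1) +
          1 / 2 * ∑ i : Edge 3 L × Fin 2 × Fin 2 × Bool, ∑ j : Edge 3 L × Fin 2 × Fin 2 × Bool,
            fderiv ℝ (fun z => fderiv ℝ f z (Pi.single i 1)) (coords V) (Pi.single j 1) *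
              ∑ n : Edge 3 L × NoiseIdx 2,
                (if n.1 = i.1 then (fun z : ℂ => if i.2.2.2 then z.im else z.re)
                  ((latticeLangevinDynamics (fundamentalLatticeRep 2) β').noise
                    (matrixConfig (fundamentalRep (Fin 2)) V) i.1 n.2 i.2.1 i.2.2.1) else 0) *
                (if n.1 = j.1 then (fun z : ℂ => if j.2.2.2 then z.im else z.re)
                  ((latticeLangevinDynamics (fundamentalLatticeRep 2) β').noise
                    (matrixConfig (fundamentalRep (Fin 2)) V) j.1 n.2 j.2.1 j.2.2.1) else 0))
        ρ * ((∫ V, f (coords V) ^ 2 * Real.log (f (coords V) ^ 2) ∂(wilsonMeasure (d := 3) (L := L) (fundamentalRep (Fin 2)) β')) -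
            (∫ V, f (coords V) ^ 2 ∂(wilsonMeasure (d := 3) (L := L) (fundamentalRep (Fin 2)) β')) *
              Real.log (∫ V, f (coords V) ^ 2 ∂(wilsonMeasure (d := 3) (L := L) (fundamentalRep (Fin 2)) β'))) ≤
          -∫ V, f (coords V) * gen V ∂(wilsonMeasure (d := 3) (L := L) (fundamentalRep (Fin 2)) β'))
    {G : GaugeConfig 3 L (Matrix.specialUnitaryGroup (Fin 2) ℂ) → ℝ} (hG : Continuous G) {η : ℝ} (hη : 0 < η) :
    ∃ h : ℝ≥0, 0 < h ∧
      (ρ - η) * ((∫ x, G x ^ 2 * Real.log (G x ^ 2) ∂(wilsonMeasure (d := 3) (L := L) (fundamentalRep (Fin 2)) β')) -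
          (∫ x, G x ^ 2 ∂(wilsonMeasure (d := 3) (L := L) (fundamentalRep (Fin 2)) β')) *
            Real.log (∫ x, G x ^ 2 ∂(wilsonMeasure (d := 3) (L := L) (fundamentalRep (Fin 2)) β'))) ≤
        (h : ℝ)⁻¹ * ((∫ x, G x * G x ∂(wilsonMeasure (d := 3) (L := L) (fundamentalRep (Fin 2)) β')) -
          ∫ x, G x * (∫ y, G y ∂(κ h x)) ∂(wilsonMeasure (d := 3) (L := L) (fundamentalRep (Fin 2)) β')) := by
  classical
  haveI := secondCountableTopology_su2
  haveI := borelSpace_config L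
  set μ : Measure (GaugeConfig 3 L (Matrix.specialUnitaryGroup (Fin 2) ℂ)) :=
    wilsonMeasure (d := 3) (L := L) (fundamentalRep (Fin 2)) β' with hμ
  haveI : IsProbabilityMeasure μ :=
    isProbabilityMeasure_wilsonMeasure (d := 3) (L := L) (fundamentalRep (Fin 2)) (continuous_fundamentalRep (Fin 2)) β'
  set En : ℝ := (∫ x, G x ^ 2 * Real.log (G x ^ 2) ∂μ) - (∫ x, G x ^ 2 ∂μ) * Real.log (∫ x, G x ^ 2 ∂μ) with hEn
  set D : ℝ≥0 → ℝ := fun h => (h : ℝ)⁻¹ * ((∫ x, G x * G x ∂μ) - ∫ x, G x * (∫ y, G y ∂(κ h x)) ∂μ) with hD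
  -- `Ent(G²) ≥ 0`
  have hG2c : Continuous fun x => G x ^ 2 := hG.pow 2
  have hGlog : Continuous fun x => G x ^ 2 * Real.log (G x ^ 2) := Real.continuous_mul_log.comp hG2c
  have hEn0 : 0 ≤ En :=
    entropy_nonneg μ (fun x => sq_nonneg (G x)) (integrable_of_continuous_of_compactSpace hG2c _)
      (integrable_of_continuous_of_compactSpace hGlog _)
  -- trivial case `(ρ − η) Ent ≤ 0`
  by_cases htriv : (ρ - η) * En ≤ 0
  · exact ⟨1, one_pos, htriv.trans (dirichletScale_nonneg L β' κ hreal 1 hG)⟩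
  have hpos : 0 < (ρ - η) * En := lt_of_not_ge htriv
  -- unbounded energies: nothing to do
  by_cases hbdd : ∃ E : ℝ, ∀ h : ℝ≥0, 0 < h → D h ≤ E
  swap
  · push Not at hbdd
    obtain ⟨h, hh, hlt⟩ := hbdd ((ρ - η) * En)
    exact ⟨h, hh, hlt.le⟩
  obtain ⟨E', hE'⟩ := hbdd
  set S : Set ℝ := D '' Ioi (0 : ℝ≥0) with hS
  have hne : S.Nonempty := ⟨D 1, 1, mem_Ioi.2 one_pos, rfl⟩
  have hbddS : BddAbove S := ⟨E', by rintro _ ⟨h, hh, rfl⟩; exact hE' h hh⟩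
  set E : ℝ := sSup S with hEdef
  have hle : ∀ h : ℝ≥0, 0 < h → D h ≤ E := fun h hh => le_csSup hbddS ⟨h, mem_Ioi.2 hh, rfl⟩
  have hE0 : 0 ≤ E := (dirichletScale_nonneg L β' κ hreal 1 hG).trans (hle 1 one_pos)
  -- KEY: `ρ Ent(G²) ≤ E`
  have hkey : ρ * En ≤ E := by
    obtain ⟨A, hA0, happrox⟩ := exists_cylinder_uniform_energy_approx L β' κ hreal hG hle
    obtain ⟨MG, hMG0, hMG⟩ := exists_abs_le_of_continuous hG
    -- for every `t ∈ (0,1]`: `ρ En ≤ (1+t) E`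
    have ht_bound : ∀ t : ℝ, 0 < t → ρ * En ≤ (1 + t) * E := by
      intro t ht
      have ht1 : 0 ≤ 1 + t := by linarith
      have ht2 : 0 ≤ 1 + t⁻¹ := by positivity
      -- the approximants along `ε_n = 1/(n+1)`
      have hεn : ∀ n : ℕ, (0 : ℝ) < 1 / ((n : ℝ) + 1) ∧ 1 / ((n : ℝ) + 1) ≤ 1 := fun n =>
        ⟨by positivity, by rw [div_le_one (by positivity)]; linarith [(Nat.cast_nonneg n : (0 : ℝ) ≤ n)]⟩
      choose f hf hfc hrest using fun n : ℕ => happrox (1 / ((n : ℝ) + 1)) (hεn n).1 (hεn n).2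
      -- `F_n := f_n ∘ coords`
      set Fs : ℕ → GaugeConfig 3 L (Matrix.specialUnitaryGroup (Fin 2) ℂ) → ℝ := fun n V =>
        f n (fun q => (fun z : ℂ => if q.2.2.2 then z.im else z.re)
          ((fundamentalRep (Fin 2) (V q.1) : Matrix (Fin 2) (Fin 2) ℂ) q.2.1 q.2.2.1)) with hFs
      have hFc : ∀ n, Continuous (Fs n) := fun n => (hf n).continuous.comp (continuous_coords (L := L))
      have hclose : ∀ n x, |G x - Fs n x| ≤ 1 / ((n : ℝ) + 1) := fun n x => (hrest n).1 x
      -- (a) `ρ Ent(F_n²) ≤ (1+t)E + (1+t⁻¹) A ε_n`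
      have hEntF : ∀ n, ρ * ((∫ V, Fs n V ^ 2 * Real.log (Fs n V ^ 2) ∂μ) -
          (∫ V, Fs n V ^ 2 ∂μ) * Real.log (∫ V, Fs n V ^ 2 ∂μ)) ≤ (1 + t) * E + (1 + t⁻¹) * (A * (1 / ((n : ℝ) + 1))) := by
        intro n
        obtain ⟨-, h₀, hh₀, hEn'⟩ := hrest n
        have hLS := hLSgen (f n) (hf n)
        have hT := tendsto_dirichletForm_semigroup L β' κ hreal (hf n) (hfc n)
        have hh₀R : (0 : ℝ) < h₀ := by exact_mod_cast hh₀
        have hbound : ∀ᶠ τ : ℝ in 𝓝[>] 0,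
            τ⁻¹ * ((∫ V, Fs n V * Fs n V ∂μ) - ∫ V, Fs n V * (∫ y, Fs n y ∂(κ τ.toNNReal V)) ∂μ) ≤
              (1 + t) * E + (1 + t⁻¹) * (A * (1 / ((n : ℝ) + 1))) := by
          filter_upwards [Ioc_mem_nhdsGT hh₀R] with τ hτ
          have hτpos : 0 < τ := hτ.1
          have hτ' : 0 < τ.toNNReal := Real.toNNReal_pos.2 hτpos
          have hτ'le : τ.toNNReal ≤ h₀ := by
            rw [← Real.toNNReal_coe (r := h₀)]; exact Real.toNNReal_le_toNNReal hτ.2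
          have hcoe : ((τ.toNNReal : ℝ≥0) : ℝ) = τ := Real.coe_toNNReal _ hτpos.le
          have hv : Continuous fun x => Fs n x - G x := (hFc n).sub hG
          have hadd := dirichletScale_add_le L β' κ hreal τ.toNNReal hG hv ht
          have e : ∀ x, G x + (Fs n x - G x) = Fs n x := fun x => by ring
          simp_rw [e] at hadd
          have h1 := hle τ.toNNReal hτ'
          have h2 := hEn' τ.toNNReal hτ' hτ'le
          simp only [hD] at h1
          rw [hcoe] at h1 h2
          calc τ⁻¹ * ((∫ V, Fs n V * Fs n V ∂μ) - ∫ V, Fs n V * (∫ y, Fs n y ∂(κ τ.toNNReal V)) ∂μ)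
              ≤ τ⁻¹ * ((1 + t) * ((∫ x, G x * G x ∂μ) - ∫ x, G x * (∫ y, G y ∂(κ τ.toNNReal x)) ∂μ) +
                  (1 + t⁻¹) * ((∫ x, (Fs n x - G x) * (Fs n x - G x) ∂μ) -
                    ∫ x, (Fs n x - G x) * (∫ y, (Fs n y - G y) ∂(κ τ.toNNReal x)) ∂μ)) :=
                mul_le_mul_of_nonneg_left hadd (inv_nonneg.2 hτpos.le)
            _ = (1 + t) * (τ⁻¹ * ((∫ x, G x * G x ∂μ) - ∫ x, G x * (∫ y, G y ∂(κ τ.toNNReal x)) ∂μ)) +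
                  (1 + t⁻¹) * (τ⁻¹ * ((∫ x, (Fs n x - G x) * (Fs n x - G x) ∂μ) -
                    ∫ x, (Fs n x - G x) * (∫ y, (Fs n y - G y) ∂(κ τ.toNNReal x)) ∂μ)) := by ring
            _ ≤ (1 + t) * E + (1 + t⁻¹) * (A * (1 / ((n : ℝ) + 1))) :=
                add_le_add (mul_le_mul_of_nonneg_left h1 ht1) (mul_le_mul_of_nonneg_left h2 ht2)
        exact mul_entropy_le_of_logSobolev_of_eventually_le (μ := μ) (Fs := Fs n)
          (B := fun (τ : ℝ) (x : GaugeConfig 3 L (Matrix.specialUnitaryGroup (Fin 2) ℂ)) => ∫ y, Fs n y ∂(κ τ.toNNReal x))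
          (fun V => rfl) hLS hT (fun τ x => integral_congr_ae (Eventually.of_forall fun y => rfl)) hbound
      -- (b) `Ent(F_n²) → Ent(G²)` by uniform convergence
      have hU : TendstoUniformly Fs G atTop := by
        rw [Metric.tendstoUniformly_iff]
        intro ε hε
        obtain ⟨N, hN⟩ := exists_nat_gt (1 / ε)
        filter_upwards [Filter.eventually_ge_atTop N] with n hn x
        rw [Real.dist_eq]
        have h1 := hclose n x
        have h2 : 1 / ((n : ℝ) + 1) < ε := by
          rw [div_lt_iff₀ (by positivity)]
          have hN' : (N : ℝ) ≤ n := by exact_mod_cast hn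
          have : 1 / ε < (n : ℝ) + 1 := by linarith
          rw [div_lt_iff₀ hε] at this
          linarith
        linarith
      have hR : ∀ n x, |Fs n x| ≤ MG + 1 := by
        intro n x
        have h1 := hclose n x
        have h2 := hMG x
        have h3 := (hεn n).2
        rw [abs_le] at h1 h2 ⊢
        constructor <;> linarith
      have hR₀ : ∀ x, |G x| ≤ MG + 1 := fun x => (hMG x).trans (by linarith)
      have hm : ∀ n, AEStronglyMeasurable (Fs n) μ := fun n => (hFc n).aestronglyMeasurable
      have hφ1 : Continuous fun x : ℝ => x ^ 2 * Real.log (x ^ 2) := by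
        have h := Real.continuous_mul_log.comp (continuous_pow 2)
        exact h
      have hφ2 : Continuous fun x : ℝ => x ^ 2 := continuous_pow 2
      have hT1 := EntropyFlow.tendsto_integral_comp_of_tendstoUniformly (ν := μ) hm hG.aestronglyMeasurable hR hR₀ hU hφ1
      have hT2 := EntropyFlow.tendsto_integral_comp_of_tendstoUniformly (ν := μ) hm hG.aestronglyMeasurable hR hR₀ hU hφ2
      have hT3 : Tendsto (fun n => (∫ V, Fs n V ^ 2 ∂μ) * Real.log (∫ V, Fs n V ^ 2 ∂μ)) atTop
          (𝓝 ((∫ x, G x ^ 2 ∂μ) * Real.log (∫ x, G x ^ 2 ∂μ))) :=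
        (Real.continuous_mul_log.tendsto _).comp hT2
      have hTent : Tendsto (fun n => ρ * ((∫ V, Fs n V ^ 2 * Real.log (Fs n V ^ 2) ∂μ) -
          (∫ V, Fs n V ^ 2 ∂μ) * Real.log (∫ V, Fs n V ^ 2 ∂μ))) atTop (𝓝 (ρ * En)) :=
        (hT1.sub hT3).const_mul ρ
      have hTrhs : Tendsto (fun n : ℕ => (1 + t) * E + (1 + t⁻¹) * (A * (1 / ((n : ℝ) + 1)))) atTop
          (𝓝 ((1 + t) * E + (1 + t⁻¹) * (A * 0))) :=
        tendsto_const_nhds.add ((tendsto_one_div_add_atTop_nhds_zero_nat.const_mul A).const_mul _)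
      rw [mul_zero, mul_zero, add_zero] at hTrhs
      exact le_of_tendsto_of_tendsto' hTent hTrhs hEntF
    -- let `t ↓ 0`
    refine le_of_forall_le_add_mul hE0 fun t ht _ => ?_
    calc ρ * En ≤ (1 + t) * E := ht_bound t ht
      _ = E + E * t := by ring
  -- conclusion: `(ρ − η) En < ρ En ≤ E = sup`, so some energy exceeds it
  have hEnpos : 0 < En := by
    rcases hEn0.lt_or_eq with h | h
    · exact h
    · exfalso; rw [← h, mul_zero] at hpos; exact lt_irrefl _ hpos
  have hlt : (ρ - η) * En < sSup S := by
    have : (ρ - η) * En < ρ * En := by nlinarith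
    exact this.trans_le hkey
  obtain ⟨_, ⟨h, hh, rfl⟩, hDlt⟩ := exists_lt_of_lt_csSup hne hlt
  exact ⟨h, mem_Ioi.1 hh, hDlt.le⟩

end Summit.QuantumFields.YangMills.Theorems.ColdStartUniversality

end
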